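/-
Copyright (c) 2026 the pub-hodgecm-mathlib formalisation cell (harness21).  Prover seat hodgecm-mathlib-K2E3-p23 (g2): Track B «K2-LIT», engine E3, line (ii′)
«H-side central germ expansion», sub-leaf (RAO-CONV_z) `sig_K2E3CentralUnipotentOrbitalConvergence` — the ASSEMBLY modulo the base-point finiteness ‹BASE_z›; 2026-09-04.
-/
import Literature.NumberTheory.Rogawski1990.UnitaryTwoOneCentralUnipotentStrataCM   -- ★ p855879 (E2b) (this seat): `fst_comm_of_mem_center`; brings the N = 2 dictionary ★ p855844 (`coe_localNonsplitEquiv_two_mem`, `…_eq_one_iff`, `sub_one_pow_eq_zero_iff_…`) and ★ `UnitaryTwoUnipotentClasses`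
import Literature.MeasureTheory.Group.OrbitalFinitenessTransport                   -- ★ p849303: `integrable_descConj_of_isConj_of_forall_measure_preimage_lt_top` (Rao finiteness transports along `IsConj`)
import Literature.NumberTheory.Rogawski1990.LocalTransferFundamentalLemma            -- ★ `IsLocSmooth`
import HarnessLib

/-!
# Ranga Rao at the classes of `H_v = U(Φ₂)(L⁺_v) × U(Φ₁)(L⁺_v)` over a central `z` FROM THE BASE-POINT FINITENESS: the one-point class `{z}`, and the transport of the
# base-point bound along conjugacy (Rao 1972; Rogawski 1990 §3.9 p. 32, §8.1 p. 112)

Topic `NumberTheory/Rogawski1990`; namespace `Literature.NumberTheory.Rogawski1990`.  THEOREMS ONLY (no definition, no instance, no notation, no named fact, no `sorry`);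
kernel lane `--supports stmt-HodgeConjecture-24833`.  Cell `pub/hodgecm-mathlib` (D-0151), crux H413 = `stmt-HodgeConjecture-24833`; Track B «K2-LIT», engine E3, tier-1 unit
`…Sigs_U3bCentralGerms`, line (ii′), leaf (E) `sig_K2E3CentralGermExpansionExistence` (★ p855998: (E) ⟸ (RAO_z)(DUAL_z); ★ p855937 (DUAL_z); p856062: (RAO_z) ⟸ (RAO-CONV_z)), sub-leaf
**(RAO-CONV_z) `sig_K2E3CentralUnipotentOrbitalConvergence`** (cand 35641b1af515a2eb, r01 PRE-BOX PASS).  Seat K2E3-p23 (g2); the base-point finiteness ‹BASE_z› is K2E5-p11 (g2)'s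
brick (the `U(1,1)` Iwasawa covering, rank-one twin of ★ p849314 `UnitaryGroup.measure_preimage_descConj_lt_top_of_coe_eq_cornerUnipotent`).
HONEST LABEL: HC_CM is proved only modulo the 7 printed citations (2 remaining named inputs: hLiu418 = stmt-HodgeConjecture-24832, h413 = stmt-HodgeConjecture-24833) until rung 0
closes.  This file is an IMPLICATION: (RAO-CONV_z) ⟸ ‹BASE_z› (stated as a hypothesis, rank-one twin of ★ p849314's head).

THE MATHEMATICS.  `z ∈ Z(H_v)`, `γ` over `z` (`((γz⁻¹)₁ − 1)² = 0 ∧ (γz⁻¹)₂ = 1`), `μ` any `H_v`-invariant measure on `H_v ⧸ Z(γ)` finite on compacta, `fH ∈ C_c^∞(H_v)`.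
* `γ = z`: `Z(z) = H_v`, the orbit space is ONE POINT, `μ` is finite and the orbital integrand is the constant `fH z` (§1, any central element of any topological group —
  the centred twin of ★ `integrable_descConj_of_eq_one`).
* `γ ≠ z`: `u := γ₁ z₁⁻¹` is a non-trivial unipotent of `U(Φ₂)(L⁺_v)`; in the one-place model `k·ψ(u)·k⁻¹ = n(t)`, `σ_w t = −t`, `t ≠ 0` (★ `exists_conj_coe_eq_lineUnipotent`), so with
  `d := ψ⁻¹ k` the base point `γ₀ := (d, 1)·γ·(d, 1)⁻¹` has `ψ((γ₀ z⁻¹)₁) = n(t)` (`z₁` central) and `(γ₀ z⁻¹)₂ = 1`, and `γ ∼ γ₀`; ‹BASE_z› bounds `μ′{y Z(γ₀) ∣ y γ₀ y⁻¹ ∈ C}` for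
  every invariant Radon `μ′` and compact `C`, which ★ `integrable_descConj_of_isConj_of_forall_measure_preimage_lt_top` transports along `γ₀ ∼ γ` to the integrability at `γ`.

* §1 `subsingleton_univ_quotient_centralizer_of_forall_comm`, `descConj_eq_const_of_forall_comm`, **`integrable_descConj_of_forall_comm`** (central element: generic group);
* §2 **`centralUnipotentOrbitalIntegrable_of_basePoint : ‹BASE_z› → ‹(RAO-CONV_z) bytes›`**.

## References
* [Rao1972] R. Ranga Rao, *Orbital integrals in reductive groups*, Ann. of Math. (2) 96 (1972) 505–510, Theorem.
* [Rogawski1990] J. D. Rogawski, *Automorphic Representations of Unitary Groups in Three Variables*, Ann. of Math. Stud. 123 (1990): §3.9 p. 32 (`n(t)`, its class and centraliser),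
  §4.9 p. 54, §8.1 p. 112.
* [HarishChandra1999AdmissibleDistributions] Harish-Chandra (DeBacker–Sally), *Admissible Invariant Distributions on Reductive p-adic Groups*, AMS ULS 16 (1999), §3.1 p. 17.
-/

set_option autoImplicit false

noncomputable section

open scoped Matrix MatrixGroups Classical ENNReal
open MeasureTheory Measure NumberField IsDedekindDomain Matrix Set Topology Filter

/-! ## §1 The class of a central element: one-point orbit space (generic group) -/

namespace Literature.MeasureTheory.Group

section CentralClass

variable {G : Type*} [Group G] {z : G} (hz : ∀ g : G, g * z = z * g)

include hz in
/-- The orbit space `G ⧸ Z(z)` of a central `z` is a single point (`Z(z) = G`). [cite: Rogawski1990, §4.9 p. 54] -/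
theorem subsingleton_univ_quotient_centralizer_of_forall_comm :
    (univ : Set (G ⧸ Subgroup.centralizer (({z} : Set G)))).Subsingleton := by
  intro a _ b _
  induction a using QuotientGroup.induction_on with
  | H x =>
    induction b using QuotientGroup.induction_on with
    | H y =>
      refine QuotientGroup.eq.2 (Subgroup.mem_centralizer_iff.2 ?_)
      rintro g hg
      rw [Set.mem_singleton_iff.1 hg]
      exact (hz _).symm

include hz in
/-- The orbital integrand at a central `z` is the constant `f z`. [cite: Rogawski1990, §4.9 p. 54] -/
theorem descConj_eq_const_of_forall_comm {α : Type*} (f : G → α) :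
    descConj z (Subgroup.centralizer (({z} : Set G))) (fun _ hg => Subgroup.mem_centralizer_singleton_iff.1 hg) f = fun _ => f z := by
  funext y
  induction y using QuotientGroup.induction_on with
  | H x => rw [descConj_mk, hz x, mul_inv_cancel_right]

include hz in
/-- **The Ranga-Rao clause at a central class**: for ANY measure on the one-point space `G ⧸ Z(z)` finite on compacta, every `f : G → ℂ` has an integrable orbital integrand at the
central `z` (the constant `f z` on a space of finite mass) — the centred twin of ★ `integrable_descConj_of_eq_one`. [cite: Rao1972, Theorem] [cite: Rogawski1990, §4.9 p. 54] -/
theorem integrable_descConj_of_forall_comm [TopologicalSpace G] [MeasurableSpace (G ⧸ Subgroup.centralizer (({z} : Set G)))]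
    (μ : Measure (G ⧸ Subgroup.centralizer (({z} : Set G)))) [IsFiniteMeasureOnCompacts μ] (f : G → ℂ) :
    Integrable (descConj z (Subgroup.centralizer (({z} : Set G))) (fun _ hg => Subgroup.mem_centralizer_singleton_iff.1 hg) f) μ := by
  have hfin : μ univ < ∞ := (subsingleton_univ_quotient_centralizer_of_forall_comm hz).isCompact.measure_lt_top
  haveI : IsFiniteMeasure μ := ⟨hfin⟩
  rw [descConj_eq_const_of_forall_comm hz f]
  exact integrable_const _

end CentralClass

end Literature.MeasureTheory.Group

/-! ## §2 (RAO-CONV_z) from the base-point finiteness -/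

namespace Literature.NumberTheory.Rogawski1990

open Literature.NumberTheory.Automorphic Literature.NumberTheory.Automorphic.UnitaryGroup Literature.NumberTheory.GaloisRepresentations
open Literature.NumberTheory.Automorphic.HermitianLattice Literature.MeasureTheory.Group

set_option maxHeartbeats 3200000 in
-- statement-heavy: two ∀-closed statements on the product carrier; the proof is a transport
/-- **(RAO-CONV_z) ⟸ ‹BASE_z›** — Ranga Rao's convergence at EVERY class of `H_v` over a central `z`, for EVERY invariant Radon measure, from the BASE-POINT FINITENESS `hbase`:
«for `t` skew, `t ≠ 0`, and `γ₀` over `z` with `ψ((γ₀z⁻¹)₁) = n(t)`, every `H_v`-invariant Radon `μ′` on `H_v ⧸ Z(γ₀)` gives finite mass to `{y Z(γ₀) ∣ y γ₀ y⁻¹ ∈ C}`, `C` compact»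
(the rank-one twin of ★ p849314's head; K2E5-p11 (g2)'s brick).  The conclusion is the cand letter `sig_K2E3CentralUnipotentOrbitalConvergence` (35641b1af515a2eb) read in `Literature`
vocabulary (same proposition).  `γ = z`: §1.  `γ ≠ z`: normal form through the one-place model + `IsConj` transport ★ `integrable_descConj_of_isConj_of_forall_measure_preimage_lt_top`.
[cite: Rao1972, Theorem] [cite: Rogawski1990, §3.9 p. 32; §8.1 Prop. 8.1.1 p. 112] [cite: HarishChandra1999AdmissibleDistributions, §3.1 p. 17] -/
theorem centralUnipotentOrbitalIntegrable_of_basePoint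
    (hbase :
      ∀ (L : Type) [Field L] [NumberField L] [IsCMField L] (v : HeightOneSpectrum (𝓞 ↥(maximalRealSubfield L))) (w : UnitaryGroup.PlacesOver L v)
        (hw : IsCMField.complexConj L • w.1 = w.1)
        [MeasurableSpace ((cmDatum L 2 (Matrix.of fun i j : Fin 2 => if i.val + j.val + 1 = 2 then (1 : L) else 0)).Local v × (cmDatum L 1 (Matrix.of fun i j : Fin 1 => if i.val + j.val + 1 = 1 then (1 : L) else 0)).Local v)] [BorelSpace ((cmDatum L 2 (Matrix.of fun i j : Fin 2 => if i.val + j.val + 1 = 2 then (1 : L) else 0)).Local v × (cmDatum L 1 (Matrix.of fun i j : Fin 1 => if i.val + j.val + 1 = 1 then (1 : L) else 0)).Local v)]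
      [∀ a : (cmDatum L 2 (Matrix.of fun i j : Fin 2 => if i.val + j.val + 1 = 2 then (1 : L) else 0)).Local v × (cmDatum L 1 (Matrix.of fun i j : Fin 1 => if i.val + j.val + 1 = 1 then (1 : L) else 0)).Local v,
        MeasurableSpace (((cmDatum L 2 (Matrix.of fun i j : Fin 2 => if i.val + j.val + 1 = 2 then (1 : L) else 0)).Local v × (cmDatum L 1 (Matrix.of fun i j : Fin 1 => if i.val + j.val + 1 = 1 then (1 : L) else 0)).Local v) ⧸ Subgroup.centralizer ({a} : Set ((cmDatum L 2 (Matrix.of fun i j : Fin 2 => if i.val + j.val + 1 = 2 then (1 : L) else 0)).Local v × (cmDatum L 1 (Matrix.of fun i j : Fin 1 => if i.val + j.val + 1 = 1 then (1 : L) else 0)).Local v)))]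
      [∀ a : (cmDatum L 2 (Matrix.of fun i j : Fin 2 => if i.val + j.val + 1 = 2 then (1 : L) else 0)).Local v × (cmDatum L 1 (Matrix.of fun i j : Fin 1 => if i.val + j.val + 1 = 1 then (1 : L) else 0)).Local v,
        BorelSpace (((cmDatum L 2 (Matrix.of fun i j : Fin 2 => if i.val + j.val + 1 = 2 then (1 : L) else 0)).Local v × (cmDatum L 1 (Matrix.of fun i j : Fin 1 => if i.val + j.val + 1 = 1 then (1 : L) else 0)).Local v) ⧸ Subgroup.centralizer ({a} : Set ((cmDatum L 2 (Matrix.of fun i j : Fin 2 => if i.val + j.val + 1 = 2 then (1 : L) else 0)).Local v × (cmDatum L 1 (Matrix.of fun i j : Fin 1 => if i.val + j.val + 1 = 1 then (1 : L) else 0)).Local v)))],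
      ∀ z : (cmDatum L 2 (Matrix.of fun i j : Fin 2 => if i.val + j.val + 1 = 2 then (1 : L) else 0)).Local v × (cmDatum L 1 (Matrix.of fun i j : Fin 1 => if i.val + j.val + 1 = 1 then (1 : L) else 0)).Local v, z ∈ Subgroup.center ((cmDatum L 2 (Matrix.of fun i j : Fin 2 => if i.val + j.val + 1 = 2 then (1 : L) else 0)).Local v × (cmDatum L 1 (Matrix.of fun i j : Fin 1 => if i.val + j.val + 1 = 1 then (1 : L) else 0)).Local v) →
      ∀ t : w.1.adicCompletion L, galAdicCompletionMap (L := L) (IsCMField.complexConj L) hw t + t = 0 → t ≠ 0 →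
      ∀ γ₀ : (cmDatum L 2 (Matrix.of fun i j : Fin 2 => if i.val + j.val + 1 = 2 then (1 : L) else 0)).Local v × (cmDatum L 1 (Matrix.of fun i j : Fin 1 => if i.val + j.val + 1 = 1 then (1 : L) else 0)).Local v,
        (((localNonsplitEquiv (IsCMField.complexConj L) (Matrix.of fun i j : Fin 2 => if i.val + j.val + 1 = 2 then (1 : L) else 0) (IsCMField.complexConj_ne_one L) w hw (γ₀ * z⁻¹).1 :
          ↥(unitaryGroupOfForm (galAdicCompletionMap (L := L) (IsCMField.complexConj L) hw) (placeForm (Matrix.of fun i j : Fin 2 => if i.val + j.val + 1 = 2 then (1 : L) else 0) w.1))) :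
            GL (Fin 2) (w.1.adicCompletion L)) : Matrix (Fin 2) (Fin 2) (w.1.adicCompletion L)) = !![1, t; 0, 1] →
        (γ₀ * z⁻¹).2 = 1 →
      ∀ (μ : Measure (((cmDatum L 2 (Matrix.of fun i j : Fin 2 => if i.val + j.val + 1 = 2 then (1 : L) else 0)).Local v × (cmDatum L 1 (Matrix.of fun i j : Fin 1 => if i.val + j.val + 1 = 1 then (1 : L) else 0)).Local v) ⧸ Subgroup.centralizer ({γ₀} : Set ((cmDatum L 2 (Matrix.of fun i j : Fin 2 => if i.val + j.val + 1 = 2 then (1 : L) else 0)).Local v × (cmDatum L 1 (Matrix.of fun i j : Fin 1 => if i.val + j.val + 1 = 1 then (1 : L) else 0)).Local v))))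
        [SMulInvariantMeasure ((cmDatum L 2 (Matrix.of fun i j : Fin 2 => if i.val + j.val + 1 = 2 then (1 : L) else 0)).Local v × (cmDatum L 1 (Matrix.of fun i j : Fin 1 => if i.val + j.val + 1 = 1 then (1 : L) else 0)).Local v) (((cmDatum L 2 (Matrix.of fun i j : Fin 2 => if i.val + j.val + 1 = 2 then (1 : L) else 0)).Local v × (cmDatum L 1 (Matrix.of fun i j : Fin 1 => if i.val + j.val + 1 = 1 then (1 : L) else 0)).Local v) ⧸ Subgroup.centralizer ({γ₀} : Set ((cmDatum L 2 (Matrix.of fun i j : Fin 2 => if i.val + j.val + 1 = 2 then (1 : L) else 0)).Local v × (cmDatum L 1 (Matrix.of fun i j : Fin 1 => if i.val + j.val + 1 = 1 then (1 : L) else 0)).Local v))) μ] [IsFiniteMeasureOnCompacts μ]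
        (C : Set ((cmDatum L 2 (Matrix.of fun i j : Fin 2 => if i.val + j.val + 1 = 2 then (1 : L) else 0)).Local v × (cmDatum L 1 (Matrix.of fun i j : Fin 1 => if i.val + j.val + 1 = 1 then (1 : L) else 0)).Local v)), IsCompact C →
          μ (descConj γ₀ (Subgroup.centralizer ({γ₀} : Set ((cmDatum L 2 (Matrix.of fun i j : Fin 2 => if i.val + j.val + 1 = 2 then (1 : L) else 0)).Local v × (cmDatum L 1 (Matrix.of fun i j : Fin 1 => if i.val + j.val + 1 = 1 then (1 : L) else 0)).Local v))) (fun _ hg => Subgroup.mem_centralizer_singleton_iff.1 hg) id ⁻¹' C) < ⊤) :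
    ∀ (L : Type) [Field L] [NumberField L] [IsCMField L] (v : HeightOneSpectrum (𝓞 ↥(maximalRealSubfield L)))
      [MeasurableSpace ((cmDatum L 2 (Matrix.of fun i j : Fin 2 => if i.val + j.val + 1 = 2 then (1 : L) else 0)).Local v × (cmDatum L 1 (Matrix.of fun i j : Fin 1 => if i.val + j.val + 1 = 1 then (1 : L) else 0)).Local v)] [BorelSpace ((cmDatum L 2 (Matrix.of fun i j : Fin 2 => if i.val + j.val + 1 = 2 then (1 : L) else 0)).Local v × (cmDatum L 1 (Matrix.of fun i j : Fin 1 => if i.val + j.val + 1 = 1 then (1 : L) else 0)).Local v)]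
      [∀ a : (cmDatum L 2 (Matrix.of fun i j : Fin 2 => if i.val + j.val + 1 = 2 then (1 : L) else 0)).Local v × (cmDatum L 1 (Matrix.of fun i j : Fin 1 => if i.val + j.val + 1 = 1 then (1 : L) else 0)).Local v,
        MeasurableSpace (((cmDatum L 2 (Matrix.of fun i j : Fin 2 => if i.val + j.val + 1 = 2 then (1 : L) else 0)).Local v × (cmDatum L 1 (Matrix.of fun i j : Fin 1 => if i.val + j.val + 1 = 1 then (1 : L) else 0)).Local v) ⧸ Subgroup.centralizer ({a} : Set ((cmDatum L 2 (Matrix.of fun i j : Fin 2 => if i.val + j.val + 1 = 2 then (1 : L) else 0)).Local v × (cmDatum L 1 (Matrix.of fun i j : Fin 1 => if i.val + j.val + 1 = 1 then (1 : L) else 0)).Local v)))]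
      [∀ a : (cmDatum L 2 (Matrix.of fun i j : Fin 2 => if i.val + j.val + 1 = 2 then (1 : L) else 0)).Local v × (cmDatum L 1 (Matrix.of fun i j : Fin 1 => if i.val + j.val + 1 = 1 then (1 : L) else 0)).Local v,
        BorelSpace (((cmDatum L 2 (Matrix.of fun i j : Fin 2 => if i.val + j.val + 1 = 2 then (1 : L) else 0)).Local v × (cmDatum L 1 (Matrix.of fun i j : Fin 1 => if i.val + j.val + 1 = 1 then (1 : L) else 0)).Local v) ⧸ Subgroup.centralizer ({a} : Set ((cmDatum L 2 (Matrix.of fun i j : Fin 2 => if i.val + j.val + 1 = 2 then (1 : L) else 0)).Local v × (cmDatum L 1 (Matrix.of fun i j : Fin 1 => if i.val + j.val + 1 = 1 then (1 : L) else 0)).Local v)))],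
      Subsingleton (UnitaryGroup.PlacesOver L v) →
    ∀ z : (cmDatum L 2 (Matrix.of fun i j : Fin 2 => if i.val + j.val + 1 = 2 then (1 : L) else 0)).Local v × (cmDatum L 1 (Matrix.of fun i j : Fin 1 => if i.val + j.val + 1 = 1 then (1 : L) else 0)).Local v, z ∈ Subgroup.center ((cmDatum L 2 (Matrix.of fun i j : Fin 2 => if i.val + j.val + 1 = 2 then (1 : L) else 0)).Local v × (cmDatum L 1 (Matrix.of fun i j : Fin 1 => if i.val + j.val + 1 = 1 then (1 : L) else 0)).Local v) →
    ∀ γ : (cmDatum L 2 (Matrix.of fun i j : Fin 2 => if i.val + j.val + 1 = 2 then (1 : L) else 0)).Local v × (cmDatum L 1 (Matrix.of fun i j : Fin 1 => if i.val + j.val + 1 = 1 then (1 : L) else 0)).Local v,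
      (((((γ * z⁻¹).1).val : GL (Fin 2) (UnitaryGroup.LocalRing L v)).val - 1) ^ 2 = 0 ∧ (γ * z⁻¹).2 = 1) →
    ∀ (μ : Measure (((cmDatum L 2 (Matrix.of fun i j : Fin 2 => if i.val + j.val + 1 = 2 then (1 : L) else 0)).Local v × (cmDatum L 1 (Matrix.of fun i j : Fin 1 => if i.val + j.val + 1 = 1 then (1 : L) else 0)).Local v) ⧸ Subgroup.centralizer ({γ} : Set ((cmDatum L 2 (Matrix.of fun i j : Fin 2 => if i.val + j.val + 1 = 2 then (1 : L) else 0)).Local v × (cmDatum L 1 (Matrix.of fun i j : Fin 1 => if i.val + j.val + 1 = 1 then (1 : L) else 0)).Local v))))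
      [SMulInvariantMeasure ((cmDatum L 2 (Matrix.of fun i j : Fin 2 => if i.val + j.val + 1 = 2 then (1 : L) else 0)).Local v × (cmDatum L 1 (Matrix.of fun i j : Fin 1 => if i.val + j.val + 1 = 1 then (1 : L) else 0)).Local v) (((cmDatum L 2 (Matrix.of fun i j : Fin 2 => if i.val + j.val + 1 = 2 then (1 : L) else 0)).Local v × (cmDatum L 1 (Matrix.of fun i j : Fin 1 => if i.val + j.val + 1 = 1 then (1 : L) else 0)).Local v) ⧸ Subgroup.centralizer ({γ} : Set ((cmDatum L 2 (Matrix.of fun i j : Fin 2 => if i.val + j.val + 1 = 2 then (1 : L) else 0)).Local v × (cmDatum L 1 (Matrix.of fun i j : Fin 1 => if i.val + j.val + 1 = 1 then (1 : L) else 0)).Local v))) μ] [IsFiniteMeasureOnCompacts μ],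
    ∀ fH : (cmDatum L 2 (Matrix.of fun i j : Fin 2 => if i.val + j.val + 1 = 2 then (1 : L) else 0)).Local v × (cmDatum L 1 (Matrix.of fun i j : Fin 1 => if i.val + j.val + 1 = 1 then (1 : L) else 0)).Local v → ℂ, IsLocSmooth fH →
      Integrable (descConj γ (Subgroup.centralizer ({γ} : Set ((cmDatum L 2 (Matrix.of fun i j : Fin 2 => if i.val + j.val + 1 = 2 then (1 : L) else 0)).Local v × (cmDatum L 1 (Matrix.of fun i j : Fin 1 => if i.val + j.val + 1 = 1 then (1 : L) else 0)).Local v))) (fun _ hg => Subgroup.mem_centralizer_singleton_iff.1 hg) fH) μ := by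
  intro L _ _ _ v _ _ _ _ hsub z hz γ hγ μ _ _ fH hfH
  haveI : Algebra.IsQuadraticExtension ↥(maximalRealSubfield L) L := IsCMField.isQuadraticExtension L
  have hzc : ∀ g : (cmDatum L 2 (Matrix.of fun i j : Fin 2 => if i.val + j.val + 1 = 2 then (1 : L) else 0)).Local v × (cmDatum L 1 (Matrix.of fun i j : Fin 1 => if i.val + j.val + 1 = 1 then (1 : L) else 0)).Local v, g * z = z * g := fun g => Subgroup.mem_center_iff.1 hz g
  by_cases hγz : γ = z
  · -- the central class: one-point orbit space
    subst hγz
    exact integrable_descConj_of_forall_comm hzc μ fH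
  -- a class `z·(u, 1)`, `u ≠ 1` unipotent
  obtain ⟨w⟩ := UnitaryGroup.PlacesOver.nonempty L v
  have hw : IsCMField.complexConj L • w.1 = w.1 := smul_placesOver_eq_of_subsingleton L v (IsCMField.complexConj L) hsub w
  have hσσ : ∀ x : w.1.adicCompletion L, galAdicCompletionMap (L := L) (IsCMField.complexConj L) hw (galAdicCompletionMap (L := L) (IsCMField.complexConj L) hw x) = x :=
    galAdicCompletionMap_galAdicCompletionMap_of_smul_eq (IsCMField.complexConj L) w (IsCMField.complexConj_ne_one L) hw
  have hu0 : (γ * z⁻¹).1 ≠ 1 := by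
    intro h
    apply hγz
    have h1 : γ.1 = z.1 := by
      have h' : γ.1 * z.1⁻¹ = 1 := h
      exact mul_inv_eq_one.1 h'
    exact Prod.ext h1 (mul_inv_eq_one.1 hγ.2)
  -- the one-place model read in `GL₂(L_w)`
  obtain ⟨ψ, hψ⟩ : ∃ ψ : (cmDatum L 2 (Matrix.of fun i j : Fin 2 => if i.val + j.val + 1 = 2 then (1 : L) else 0)).Local v → GL (Fin 2) (w.1.adicCompletion L), ∀ y, ψ y =
      ((localNonsplitEquiv (IsCMField.complexConj L) (Matrix.of fun i j : Fin 2 => if i.val + j.val + 1 = 2 then (1 : L) else 0) (IsCMField.complexConj_ne_one L) w hw y :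
        ↥(unitaryGroupOfForm (galAdicCompletionMap (L := L) (IsCMField.complexConj L) hw)
          (placeForm (Matrix.of fun i j : Fin 2 => if i.val + j.val + 1 = 2 then (1 : L) else 0) w.1))) : GL (Fin 2) (w.1.adicCompletion L)) :=
    ⟨_, fun _ => rfl⟩
  have hψmul : ∀ y y', ψ (y * y') = ψ y * ψ y' := fun y y' => by
    rw [hψ, hψ, hψ]
    exact congrArg Subtype.val (map_mul (localNonsplitEquiv (IsCMField.complexConj L) _ (IsCMField.complexConj_ne_one L) w hw) y y')
  have hψinv : ∀ y, ψ y⁻¹ = (ψ y)⁻¹ := fun y => by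
    rw [hψ, hψ]
    exact congrArg Subtype.val (map_inv (localNonsplitEquiv (IsCMField.complexConj L) _ (IsCMField.complexConj_ne_one L) w hw) y)
  have hψU : ∀ y, ψ y ∈ unitaryGroupOfForm (galAdicCompletionMap (L := L) (IsCMField.complexConj L) hw) ((StdForm.antidiagonal 2).over (w.1.adicCompletion L)) :=
    fun y => by rw [hψ]; exact coe_localNonsplitEquiv_two_mem L w hw y
  have hψsq : (((ψ (γ * z⁻¹).1 : GL (Fin 2) (w.1.adicCompletion L)) : Matrix (Fin 2) (Fin 2) (w.1.adicCompletion L)) - 1) ^ 2 = 0 := by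
    rw [hψ]; exact (sub_one_pow_eq_zero_iff_coe_localNonsplitEquiv_two L w hw hsub _ 2).1 hγ.1
  -- normal form `k (ψ u) k⁻¹ = n(t)`, `t` skew, `t ≠ 0`
  obtain ⟨k, hk, t, hσt, hshape⟩ := exists_conj_coe_eq_lineUnipotent (galAdicCompletionMap (L := L) (IsCMField.complexConj L) hw) hσσ (hψU (γ * z⁻¹).1) ⟨2, hψsq⟩
  have ht : t ≠ 0 := by
    intro ht0
    apply hu0
    have h1 : k * ψ (γ * z⁻¹).1 * k⁻¹ = 1 := Units.ext (by rw [hshape, ht0, Units.val_one]; ext i j; fin_cases i <;> fin_cases j <;> rfl)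
    have h2 : ψ (γ * z⁻¹).1 = 1 := by
      calc ψ (γ * z⁻¹).1 = k⁻¹ * (k * ψ (γ * z⁻¹).1 * k⁻¹) * k := by group
        _ = 1 := by rw [h1]; group
    rw [hψ] at h2
    exact (coe_localNonsplitEquiv_two_eq_one_iff L w hw _).1 h2
  -- `d := ψ⁻¹ k`, the base point `γ₀ := (d, 1) γ (d, 1)⁻¹`
  have hk' : k ∈ unitaryGroupOfForm (galAdicCompletionMap (L := L) (IsCMField.complexConj L) hw) (placeForm (Matrix.of fun i j : Fin 2 => if i.val + j.val + 1 = 2 then (1 : L) else 0) w.1) := by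
    rw [placeForm_antidiagTwo_eq_over L w]; exact hk
  obtain ⟨d, hd⟩ : ∃ d : (cmDatum L 2 (Matrix.of fun i j : Fin 2 => if i.val + j.val + 1 = 2 then (1 : L) else 0)).Local v, ψ d = k :=
    ⟨(localNonsplitEquiv (IsCMField.complexConj L) _ (IsCMField.complexConj_ne_one L) w hw).symm ⟨k, hk'⟩, by
      rw [hψ]
      exact congrArg Subtype.val ((localNonsplitEquiv (IsCMField.complexConj L) _ (IsCMField.complexConj_ne_one L) w hw).apply_symm_apply ⟨k, hk'⟩)⟩
  set γ₀ : (cmDatum L 2 (Matrix.of fun i j : Fin 2 => if i.val + j.val + 1 = 2 then (1 : L) else 0)).Local v × (cmDatum L 1 (Matrix.of fun i j : Fin 1 => if i.val + j.val + 1 = 1 then (1 : L) else 0)).Local v := (d, 1) * γ * (d, 1)⁻¹ with hγ₀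
  have hconj : IsConj γ₀ γ := isConj_iff.2 ⟨(d, 1)⁻¹, by rw [hγ₀]; group⟩
  -- `(γ₀ z⁻¹)₁ = d u d⁻¹` (`z₁` central) and `(γ₀ z⁻¹)₂ = 1`
  have hfst : (γ₀ * z⁻¹).1 = d * (γ * z⁻¹).1 * d⁻¹ := by
    have e1 : (γ₀ * z⁻¹).1 = d * γ.1 * d⁻¹ * z.1⁻¹ := rfl
    have e2 : (γ * z⁻¹).1 = γ.1 * z.1⁻¹ := rfl
    rw [e1, e2]
    simp only [mul_assoc]
    rw [(fst_comm_of_mem_center hz d⁻¹).2]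
  have hsnd : (γ₀ * z⁻¹).2 = 1 := by
    have e1 : (γ₀ * z⁻¹).2 = 1 * γ.2 * 1⁻¹ * z.2⁻¹ := rfl
    have e2 : (γ * z⁻¹).2 = γ.2 * z.2⁻¹ := rfl
    rw [e1, one_mul, inv_one, mul_one, ← e2]
    exact hγ.2
  have hbase0 : (((localNonsplitEquiv (IsCMField.complexConj L) (Matrix.of fun i j : Fin 2 => if i.val + j.val + 1 = 2 then (1 : L) else 0) (IsCMField.complexConj_ne_one L) w hw (γ₀ * z⁻¹).1 :
      ↥(unitaryGroupOfForm (galAdicCompletionMap (L := L) (IsCMField.complexConj L) hw) (placeForm (Matrix.of fun i j : Fin 2 => if i.val + j.val + 1 = 2 then (1 : L) else 0) w.1))) :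
        GL (Fin 2) (w.1.adicCompletion L)) : Matrix (Fin 2) (Fin 2) (w.1.adicCompletion L)) = !![1, t; 0, 1] := by
    rw [← hψ, hfst, hψmul, hψmul, hψinv, hd]
    exact hshape
  -- transport the base-point finiteness along `γ₀ ∼ γ`
  exact integrable_descConj_of_isConj_of_forall_measure_preimage_lt_top
    (fun μ' _ _ C hC => hbase L v w hw z hz t hσt ht γ₀ hbase0 hsnd μ' C hC) hconj μ hfH.1.continuous hfH.2

end Literature.NumberTheory.Rogawski1990

end
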